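import Summits.QuantumFields.BalabanUV.T4Continuum.Support.ShellMeasureWilsonBlock
import Summits.QuantumFields.BalabanUV.T4Continuum.Support.ShellMeasureExpChartSUN

/-!
# `T4Continuum.ShellMeasureWilsonRealizedSUNWords` — (M1)₀ REALIZED for `G = SU(N)`, EVERY `N`, file 1 of 2: in the
# exponential block chart of `SU(N)` every plaquette holonomy of the sectioned configuration IS a word of exponentials
# of skew-Hermitian generators real-linear in the chart point, with frozen unitary exterior letters; sizes on the
# chart ball from the ONE new inequality `‖X‖_op ≤ ‖X‖_HS` on `M_N(ℂ)`
# (cell `pub-balaban`, sub-cell `t4`, spine estimate NE7c (node U5b); ROUND-2 crew `t4-ne7c-formalise-*`, seat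
# `b2b-balaban-t4-ne7c-formalise-leaf-10` (gen 7); OFFERED leaf «(M1)₀ REALIZED FOR SU(N) — THE LEVEL-0 FACE OF THE
# SU(N) ROAD» (journal `CLAIMS.log` l.12031; orbit of rows S3∕S30∕S31 of `t4/b2b-balaban-t4-ne7c-p1/LEAVES-NE7c-P1.md`,
# trigger `t4/T4-NE7c-TRIGGER.json` c5: optional — `SU(2)` is the row's certified instance); the `SU(N)` twin, WORD FOR
# WORD, of `ShellMeasureWilsonRealizedSU2Words` (lineage t4-ne7c-p1 gen 25, p206536); ADDITIVE — imports
# `ShellMeasureWilsonBlock` (trace datum `matrixTrace`, admissible letters, (S-ii)₀) and `ShellMeasureExpChartSUN` (the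
# `SU(N)` chart: `genSU`, `expPtSU`, `expFibreChartSU`, `BlockChartSU`) only and modifies nothing; 0 sorry, 0 citations,
# no `def … : Prop`)

HONEST FRAMING.  Finite four-torus programme, rung (B)+1 only — NOT infinite volume, NOT a mass gap, NOT the Clay
problem, NOT summit progress; (B), `BetaPertHyp`, (B^μ) are not mentioned because nothing here consumes them.  The
cell wall of NE7c — (M1) `T4ShellMeasure.SlotAntiConcentration` FOR BAŁABAN'S INDUCTIVELY DEFINED EFFECTIVE MEASURES —
is NOT PRINTED in [Balaban 1983–89] (GAPS G-ne7cp1-1), asserted by nobody, and NOT moved by this file; NOTHING in the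
countdown moves (spine PROVED 0/9); the headline of file 2 reads «(M1)₀ realized for the bare `SU(N)` Wilson block»,
never «NE7c proved» (trigger c3: (M1)₀ realized ≠ NE7c).  Every declaration is [folklore] kernel mathematics
(finite-dimensional linear algebra, the matrix exponential), by NAME over tree theorems.  HONEST DEPENDENCY (cell):
continuum YM on T⁴ ⇐ BetaPertH ∧ nine spine estimates (0/9 proved); BetaPertH ⇐ (D1) ∧ (D4) ∧ CAP+tail; G-an2-4 gates
asym, D1 and NE2/3/4.

THE POINT.  The `SU(2)` level-0 face Z0 (`ShellMeasureWilsonRealizedSU2.slotAntiConcentration_wilson_su2`, p206694)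
rests on the DICTIONARY of `ShellMeasureWilsonRealizedSU2Words`: in the quaternion exponential chart every block bond
of the sectioned configuration `V[Λ := chart x]` is `exp (gen_b x)` with `gen_b x` skew-Hermitian and real-linear in
`x`, so every plaquette holonomy is a word of letters `exp(c·Y)` ∕ frozen unitaries to which the generic word
estimates (`ShellMeasureWilsonWords`, `ShellMeasureWilsonTrace`, `ShellMeasureWilsonBlock`) apply.  Row S3 built the
exponential chart of `SU(N)` in orthonormal Hilbert–Schmidt coordinates of `𝔰𝔲(N)` (`ShellMeasureExpChartSUN`:
`genSU v = coordSU v`, `expPtSU v = exp (genSU v)`, block chart `expFibreChartSU`, block chart space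
`BlockChartSU N Λ = Λ → ℝ^{d_N}` with the sup norm over bonds).  This file is the same dictionary at `G := SU(N)`:
* §0 **`‖X‖_op ≤ ‖X‖_HS` ON `M_N(ℂ)`** (`l2_opNorm_le_sqrt_sum_sq`: the `Matrix.Norms.L2Operator` norm — the norm of
  the cell's `UnitaryModel`, of `dist1` and of the word estimates — is at most the root of the sum of the squared
  entries, by a row-wise Cauchy–Schwarz inequality; `frobenius_norm_sq_eq_sum_sq`: that root IS the
  `Matrix.Norms.Frobenius` norm), hence **`norm_genSU_le : ‖genSU v‖_op ≤ ‖v‖`** (the chart is a Hilbert–Schmidt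
  ISOMETRY, `ShellMeasureExpChartSUN.norm_genSU`) — so on the chart ball `‖x‖ ≤ S` every bond generator has operator
  norm `≤ S` (`norm_gen_le`; for `SU(2)` the cube of half-side `S` gave `2S`).
* §1 letters (`letter`: `±genSU (x b)` for a block bond, the frozen unitary `V b` or its adjoint for an exterior bond),
  `coe_update_eq_eval`∕`coe_update_inv_eq_eval` (the bond variables of the section ARE the letters' factors at
  `c = 1`), `letter_eval_smul` (letters move along the contraction as generators scale), `letter_good` (admissible for
  `Re Tr`: `ShellMeasureWilsonBlock.good_gen_of_mem_skewAdjoint` ∕ `good_frozen_of_mem_unitary`), `letter_sizes`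
  (`genNorm ≤ S`, `dev ≤ 2`), the sectioned plaquette word `plaqWord` with **`coe_plaqHol_eq_wordEval`** (the
  plaquette holonomy of `V[Λ := expFibreChartSU Λ 1 x]` IS `wordEval 1 (plaqWord Λ V x p)` as a matrix),
  `wordEval_plaqWord_smul`, `plaqWord_data` (`s ≤ 4S`, `d ≤ 8`), and for interior plaquettes the generator list `gens`
  with `wordEval_plaqWord_eq_wordExp`, `normSum_gens_le` (`≤ 4S`).

WHAT THIS DOES NOT DO.  No measure statement (file 2); (LR)₀, (MR)₀, anything at `j ≥ 1`; NE7c NOT proved; 0/9 spine.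
-/

noncomputable section

open NormedSpace Set Function MeasureTheory Metric

namespace Summit.QuantumFields.BalabanUV.T4Continuum.ShellMeasureWilsonRealizedSUN

open scoped ENNReal
open Literature.MathematicalPhysics.QuantumFieldTheory.Balaban1983to89
open ShellMeasureExpChartSUN
open ShellMeasureWilsonWords (scale normSum wordExp normSum_nonneg)
open ShellMeasureWilsonTrace (Letter wordEval sGen dFro TraceData)
open ShellMeasureWilsonBlock (matrixTrace good_gen_of_mem_skewAdjoint good_frozen_of_mem_unitary)

/-- `M_N(ℂ)`. [folklore] -/
abbrev MatN (N : ℕ) : Type := Matrix (Fin N) (Fin N) ℂ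

/-! ## §0 The operator norm is dominated by the Hilbert–Schmidt norm; the chart generator has operator norm `≤ ‖v‖` -/

section Frobenius

open scoped Matrix.Norms.Frobenius

variable {m : Type*} [Fintype m]

/-- the square of the FROBENIUS (Hilbert–Schmidt) norm of a complex matrix is the sum of its squared entries.
[folklore] -/
theorem frobenius_norm_sq_eq_sum_sq (A : Matrix m m ℂ) : ‖A‖ ^ 2 = ∑ i, ∑ j, ‖A i j‖ ^ 2 := by
  rw [Matrix.frobenius_norm_def, ← Real.sqrt_eq_rpow, Real.sq_sqrt (by positivity)]
  simp_rw [Real.rpow_two]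

variable {N : ℕ}

/-- the sum of the squared entries of the chart generator is `‖v‖²` (the chart `coordSU` is a Hilbert–Schmidt
isometry, `ShellMeasureExpChartSUN.norm_genSU`). [folklore] -/
theorem sum_sq_entry_genSU (v : ChartSU N) : ∑ i, ∑ j, ‖genSU v i j‖ ^ 2 = ‖v‖ ^ 2 := by
  have h1 : ‖v‖ = ‖genSU v‖ := by rw [← norm_genSU v, Submodule.coe_norm]; rfl
  rw [h1, frobenius_norm_sq_eq_sum_sq]

end Frobenius

open scoped Matrix.Norms.L2Operator

section OpNorm

variable {m : Type*} [Fintype m] [DecidableEq m]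

omit [DecidableEq m] in
/-- row-wise Cauchy–Schwarz: `‖(A y)_i‖² ≤ (Σ_j ‖A_{ij}‖²)·(Σ_j ‖y_j‖²)`. [folklore] -/
theorem norm_mulVec_apply_sq_le (A : Matrix m m ℂ) (y : m → ℂ) (i : m) :
    ‖(A.mulVec y) i‖ ^ 2 ≤ (∑ j, ‖A i j‖ ^ 2) * ∑ j, ‖y j‖ ^ 2 := by
  have h1 : ‖(A.mulVec y) i‖ ≤ ∑ j, ‖A i j‖ * ‖y j‖ := by
    rw [Matrix.mulVec, dotProduct]
    exact (norm_sum_le _ _).trans (le_of_eq (Finset.sum_congr rfl fun j _ => norm_mul _ _))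
  calc ‖(A.mulVec y) i‖ ^ 2 ≤ (∑ j, ‖A i j‖ * ‖y j‖) ^ 2 := pow_le_pow_left₀ (norm_nonneg _) h1 2
    _ ≤ (∑ j, ‖A i j‖ ^ 2) * ∑ j, ‖y j‖ ^ 2 := Finset.sum_mul_sq_le_sq_mul_sq _ _ _

/-- **THE `L²`-OPERATOR NORM IS DOMINATED BY THE HILBERT–SCHMIDT NORM**: `‖A‖_op ≤ √(Σ_{ij} ‖A_{ij}‖²)` on `M_m(ℂ)`
(Mathlib scope `Matrix.Norms.L2Operator` — the norm of the cell's `UnitaryModel`, of `dist1`, and of the word estimates).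
[folklore] -/
theorem l2_opNorm_le_sqrt_sum_sq (A : Matrix m m ℂ) : ‖A‖ ≤ Real.sqrt (∑ i, ∑ j, ‖A i j‖ ^ 2) := by
  rw [← Matrix.l2_opNorm_toEuclideanCLM]
  refine ContinuousLinearMap.opNorm_le_bound _ (Real.sqrt_nonneg _) fun x => ?_
  have hsum0 : 0 ≤ ∑ i, ∑ j, ‖A i j‖ ^ 2 := by positivity
  have hle : ‖Matrix.toEuclideanCLM (n := m) (𝕜 := ℂ) A x‖ ^ 2 ≤ (∑ i, ∑ j, ‖A i j‖ ^ 2) * ‖x‖ ^ 2 := by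
    rw [EuclideanSpace.norm_sq_eq, EuclideanSpace.norm_sq_eq x, Finset.sum_mul]
    exact Finset.sum_le_sum fun i _ => norm_mulVec_apply_sq_le A _ i
  calc ‖Matrix.toEuclideanCLM (n := m) (𝕜 := ℂ) A x‖
      = Real.sqrt (‖Matrix.toEuclideanCLM (n := m) (𝕜 := ℂ) A x‖ ^ 2) := (Real.sqrt_sq (norm_nonneg _)).symm
    _ ≤ Real.sqrt ((∑ i, ∑ j, ‖A i j‖ ^ 2) * ‖x‖ ^ 2) := Real.sqrt_le_sqrt hle
    _ = Real.sqrt (∑ i, ∑ j, ‖A i j‖ ^ 2) * ‖x‖ := by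
      rw [Real.sqrt_mul hsum0, Real.sqrt_sq (norm_nonneg _)]

end OpNorm

variable {N : ℕ} [NeZero N]

omit [NeZero N] in
/-- **THE CHART GENERATOR HAS OPERATOR NORM AT MOST THE HILBERT–SCHMIDT NORM OF THE CHART POINT**:
`‖genSU v‖_op ≤ ‖v‖`. [folklore] -/
theorem norm_genSU_le (v : ChartSU N) : ‖genSU v‖ ≤ ‖v‖ := by
  refine (l2_opNorm_le_sqrt_sum_sq _).trans (le_of_eq ?_)
  rw [sum_sq_entry_genSU v, Real.sqrt_sq (norm_nonneg _)]

variable {P : Params} {j : ℕ} [DecidableEq (PBond P j)]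

/-! ## §1 Chart bonds are exponentials of skew-Hermitian real-linear generators -/

section Letters

variable (Λ : Finset (PBond P j))

/-- the generator of the chart bond `b` at the chart point `x`: `genSU (x b)`. [folklore] -/
def gen (b : ↥Λ) (x : BlockChartSU N Λ) : MatN N := genSU (x b)

omit [NeZero N] [DecidableEq (PBond P j)] in
/-- ray-linearity of the generator. [folklore] -/
theorem gen_smul (b : ↥Λ) (c : ℝ) (x : BlockChartSU N Λ) : gen Λ b (c • x) = (c : ℂ) • gen Λ b x := by
  unfold gen
  rw [Pi.smul_apply, genSU_smul]

omit [NeZero N] [DecidableEq (PBond P j)] in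
/-- the generator is skew-Hermitian. [folklore] -/
theorem gen_mem_skewAdjoint (b : ↥Λ) (x : BlockChartSU N Λ) : gen Λ b x ∈ skewAdjoint (MatN N) :=
  genSU_mem_skewAdjoint _

omit [NeZero N] [DecidableEq (PBond P j)] in
/-- the generator's size on the chart ball: `‖gen b x‖_op ≤ S` for `‖x‖ ≤ S` (operator norm ≤ Hilbert–Schmidt norm
`= ‖x b‖ ≤ S`). [folklore] -/
theorem norm_gen_le {S : ℝ} {x : BlockChartSU N Λ} (hx : x ∈ closedBall (0 : BlockChartSU N Λ) S) (b : ↥Λ) :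
    ‖gen Λ b x‖ ≤ S :=
  (norm_genSU_le (x b)).trans (norm_apply_le_of_mem_closedBall Λ hx b)

omit [DecidableEq (PBond P j)] in
/-- THE DICTIONARY ON THE FIBRE: the chart bond of `expFibreChartSU Λ 1 x` IS `exp (gen b x)`. [folklore] -/
theorem coe_chart (x : BlockChartSU N Λ) (b : ↥Λ) :
    ((expFibreChartSU Λ (1 : GaugeField P j (SUN N)) x b : SUN N) : MatN N) = exp (gen Λ b x) := by
  rw [expFibreChartSU_apply]
  have h1 : (1 : GaugeField P j (SUN N)) (b : PBond P j) = 1 := rfl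
  rw [h1, one_mul, coe_expPtSU]
  rfl

/-- THE ORIENTED LETTER of the bond `b` in the sectioned configuration `V[Λ := chart x]`: a generator (`±gen`) for a
block bond, a frozen unitary (`V b` or its adjoint) for an exterior bond. [folklore] -/
def letter (V : GaugeField P j (SUN N)) (x : BlockChartSU N Λ) (b : PBond P j) (inv : Bool) : Letter (MatN N) :=
  if hb : b ∈ Λ then Letter.gen (if inv then -gen Λ ⟨b, hb⟩ x else gen Λ ⟨b, hb⟩ x)
  else Letter.frozen (if inv then star ((V b : SUN N) : MatN N) else ((V b : SUN N) : MatN N))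

/-- the bond variable of the sectioned configuration, as a matrix, is the letter's factor at `c = 1`. [folklore] -/
theorem coe_update_eq_eval (V : GaugeField P j (SUN N)) (x : BlockChartSU N Λ) (b : PBond P j) :
    ((updateFinset V Λ (expFibreChartSU Λ 1 x) b : SUN N) : MatN N) = (letter Λ V x b false).eval 1 := by
  unfold letter
  by_cases hb : b ∈ Λ
  · rw [dif_pos hb]
    simp only [Bool.false_eq_true, ↓reduceIte, Letter.eval_gen, Complex.ofReal_one, one_smul]
    have : updateFinset V Λ (expFibreChartSU Λ 1 x) b = expFibreChartSU Λ 1 x ⟨b, hb⟩ := by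
      simp [updateFinset, hb]
    rw [this, coe_chart]
  · rw [dif_neg hb]
    simp only [Bool.false_eq_true, ↓reduceIte, Letter.eval_frozen]
    have : updateFinset V Λ (expFibreChartSU Λ 1 x) b = V b := by simp [updateFinset, hb]
    rw [this]

/-- the same for the inverse bond variable (adjoint; `star (exp Y) = exp (−Y)` for skew `Y`). [folklore] -/
theorem coe_update_inv_eq_eval (V : GaugeField P j (SUN N)) (x : BlockChartSU N Λ) (b : PBond P j) :
    (((updateFinset V Λ (expFibreChartSU Λ 1 x) b)⁻¹ : SUN N) : MatN N) = (letter Λ V x b true).eval 1 := by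
  have hstar : (((updateFinset V Λ (expFibreChartSU Λ 1 x) b)⁻¹ : SUN N) : MatN N) =
      star ((updateFinset V Λ (expFibreChartSU Λ 1 x) b : SUN N) : MatN N) := rfl
  rw [hstar]
  unfold letter
  by_cases hb : b ∈ Λ
  · rw [dif_pos hb]
    simp only [↓reduceIte, Letter.eval_gen, Complex.ofReal_one, one_smul]
    have : updateFinset V Λ (expFibreChartSU Λ 1 x) b = expFibreChartSU Λ 1 x ⟨b, hb⟩ := by
      simp [updateFinset, hb]
    rw [this, coe_chart, star_exp, skewAdjoint.mem_iff.mp (gen_mem_skewAdjoint Λ ⟨b, hb⟩ x)]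
  · rw [dif_neg hb]
    simp only [↓reduceIte, Letter.eval_frozen]
    have : updateFinset V Λ (expFibreChartSU Λ 1 x) b = V b := by simp [updateFinset, hb]
    rw [this]

omit [NeZero N] in
/-- the letters move along the contraction exactly as generators scale: `eval₁ (letter (c•x)) = eval_c (letter x)`.
[folklore] -/
theorem letter_eval_smul (V : GaugeField P j (SUN N)) (x : BlockChartSU N Λ) (b : PBond P j) (inv : Bool) (c : ℝ) :
    (letter Λ V (c • x) b inv).eval 1 = (letter Λ V x b inv).eval c := by
  unfold letter
  by_cases hb : b ∈ Λ
  · rw [dif_pos hb, dif_pos hb]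
    cases inv <;> simp [Letter.eval, gen_smul, smul_neg]
  · rw [dif_neg hb, dif_neg hb]
    cases inv <;> simp [Letter.eval]

/-- the letters are admissible for `Re Tr`: generators skew-Hermitian, frozen letters unitary. [folklore] -/
theorem letter_good (V : GaugeField P j (SUN N)) (x : BlockChartSU N Λ) (b : PBond P j) (inv : Bool) :
    (letter Λ V x b inv).Good (matrixTrace (n := Fin N)).τ := by
  unfold letter
  by_cases hb : b ∈ Λ
  · rw [dif_pos hb]
    cases inv
    · exact good_gen_of_mem_skewAdjoint (gen_mem_skewAdjoint Λ ⟨b, hb⟩ x)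
    · exact good_gen_of_mem_skewAdjoint ((skewAdjoint (MatN N)).neg_mem (gen_mem_skewAdjoint Λ ⟨b, hb⟩ x))
  · rw [dif_neg hb]
    cases inv
    · exact good_frozen_of_mem_unitary (V b).2.1
    · exact good_frozen_of_mem_unitary (Unitary.star_mem (V b).2.1)

/-- sizes: a letter's generator norm is `≤ S` on the chart ball, its frozen deviation `≤ 2`. [folklore] -/
theorem letter_sizes {S : ℝ} (hS : 0 ≤ S) (V : GaugeField P j (SUN N)) {x : BlockChartSU N Λ}
    (hx : x ∈ closedBall (0 : BlockChartSU N Λ) S) (b : PBond P j) (inv : Bool) :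
    (letter Λ V x b inv).genNorm ≤ S ∧ (letter Λ V x b inv).dev ≤ 2 := by
  unfold letter
  by_cases hb : b ∈ Λ
  · rw [dif_pos hb]
    cases inv <;> simp only [Bool.false_eq_true, ↓reduceIte, Letter.genNorm, Letter.dev, norm_neg]
    · exact ⟨norm_gen_le Λ hx ⟨b, hb⟩, by norm_num⟩
    · exact ⟨norm_gen_le Λ hx ⟨b, hb⟩, by norm_num⟩
  · rw [dif_neg hb]
    have hU : ‖((V b : SUN N) : MatN N)‖ = 1 := CStarRing.norm_coe_unitary ⟨_, (V b).2.1⟩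
    have hUs : ‖star ((V b : SUN N) : MatN N)‖ = 1 := by rw [norm_star]; exact hU
    cases inv <;> simp only [Bool.false_eq_true, ↓reduceIte, Letter.genNorm, Letter.dev]
    · refine ⟨hS, ?_⟩
      calc ‖((V b : SUN N) : MatN N) - 1‖ ≤ ‖((V b : SUN N) : MatN N)‖ + ‖(1 : MatN N)‖ := norm_sub_le _ _
        _ = 2 := by rw [hU, norm_one]; norm_num
    · refine ⟨hS, ?_⟩
      calc ‖star ((V b : SUN N) : MatN N) - 1‖ ≤ ‖star ((V b : SUN N) : MatN N)‖ + ‖(1 : MatN N)‖ :=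
          norm_sub_le _ _
        _ = 2 := by rw [hUs, norm_one]; norm_num

/-- THE SECTIONED PLAQUETTE WORD: the four oriented letters of `∂p`. [folklore] -/
def plaqWord (V : GaugeField P j (SUN N)) (x : BlockChartSU N Λ) (p : Plaq P j) : List (Letter (MatN N)) :=
  [letter Λ V x ⟨p.src, p.μ⟩ false, letter Λ V x ⟨p.src.shift p.μ, p.ν⟩ false,
    letter Λ V x ⟨p.src.shift p.ν, p.μ⟩ true, letter Λ V x ⟨p.src, p.ν⟩ true]

/-- **THE PLAQUETTE HOLONOMY OF THE SECTIONED CONFIGURATION IS THE SECTIONED WORD** (as a matrix). [folklore] -/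
theorem coe_plaqHol_eq_wordEval (V : GaugeField P j (SUN N)) (x : BlockChartSU N Λ) (p : Plaq P j) :
    ((GaugeField.plaqHol (updateFinset V Λ (expFibreChartSU Λ 1 x)) p : SUN N) : MatN N) =
      wordEval 1 (plaqWord Λ V x p) := by
  unfold GaugeField.plaqHol plaqWord
  simp only [ShellMeasureWilsonTrace.wordEval_cons, ShellMeasureWilsonTrace.wordEval_nil, mul_one]
  rw [← coe_update_eq_eval, ← coe_update_eq_eval, ← coe_update_inv_eq_eval, ← coe_update_inv_eq_eval]
  simp only [Submonoid.coe_mul, mul_assoc]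

omit [NeZero N] in
/-- along the contraction: the word at `c•x` at parameter `1` is the word at `x` at parameter `c`. [folklore] -/
theorem wordEval_plaqWord_smul (V : GaugeField P j (SUN N)) (x : BlockChartSU N Λ) (p : Plaq P j) (c : ℝ) :
    wordEval 1 (plaqWord Λ V (c • x) p) = wordEval c (plaqWord Λ V x p) := by
  unfold plaqWord
  simp only [ShellMeasureWilsonTrace.wordEval_cons, ShellMeasureWilsonTrace.wordEval_nil, letter_eval_smul]

/-- admissibility, size and deviation of the sectioned plaquette word on the chart ball: `s ≤ 4S`, `d ≤ 8`.
[folklore] -/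
theorem plaqWord_data {S : ℝ} (hS : 0 ≤ S) (V : GaugeField P j (SUN N)) {x : BlockChartSU N Λ}
    (hx : x ∈ closedBall (0 : BlockChartSU N Λ) S) (p : Plaq P j) :
    (∀ ℓ ∈ plaqWord Λ V x p, ℓ.Good (matrixTrace (n := Fin N)).τ) ∧
      sGen (plaqWord Λ V x p) ≤ 4 * S ∧ dFro (plaqWord Λ V x p) ≤ 8 := by
  refine ⟨fun ℓ hℓ => ?_, ?_, ?_⟩
  · unfold plaqWord at hℓ
    simp only [List.mem_cons, List.not_mem_nil, or_false] at hℓ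
    rcases hℓ with h | h | h | h <;> rw [h] <;> exact letter_good Λ V x _ _
  · unfold plaqWord
    simp only [ShellMeasureWilsonTrace.sGen_cons, ShellMeasureWilsonTrace.sGen_nil]
    linarith [(letter_sizes Λ hS V hx ⟨p.src, p.μ⟩ false).1, (letter_sizes Λ hS V hx ⟨p.src.shift p.μ, p.ν⟩ false).1,
      (letter_sizes Λ hS V hx ⟨p.src.shift p.ν, p.μ⟩ true).1, (letter_sizes Λ hS V hx ⟨p.src, p.ν⟩ true).1]
  · unfold plaqWord
    simp only [ShellMeasureWilsonTrace.dFro_cons, ShellMeasureWilsonTrace.dFro_nil]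
    linarith [(letter_sizes Λ hS V hx ⟨p.src, p.μ⟩ false).2, (letter_sizes Λ hS V hx ⟨p.src.shift p.μ, p.ν⟩ false).2,
      (letter_sizes Λ hS V hx ⟨p.src.shift p.ν, p.μ⟩ true).2, (letter_sizes Λ hS V hx ⟨p.src, p.ν⟩ true).2]

/-- THE CLASSIFIER'S GENERATOR LIST of an INTERIOR plaquette (all four bonds in `Λ`). [folklore] -/
def gens (p : Plaq P j) (h1 : (⟨p.src, p.μ⟩ : PBond P j) ∈ Λ) (h2 : (⟨p.src.shift p.μ, p.ν⟩ : PBond P j) ∈ Λ)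
    (h3 : (⟨p.src.shift p.ν, p.μ⟩ : PBond P j) ∈ Λ) (h4 : (⟨p.src, p.ν⟩ : PBond P j) ∈ Λ) (x : BlockChartSU N Λ) :
    List (MatN N) :=
  [gen Λ ⟨_, h1⟩ x, gen Λ ⟨_, h2⟩ x, -gen Λ ⟨_, h3⟩ x, -gen Λ ⟨_, h4⟩ x]

omit [NeZero N] in
/-- for an interior plaquette the sectioned word at parameter `c` is the word of exponentials of the SCALED
generators (exterior-independent). [folklore] -/
theorem wordEval_plaqWord_eq_wordExp (V : GaugeField P j (SUN N)) (x : BlockChartSU N Λ) (p : Plaq P j)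
    (h1 : (⟨p.src, p.μ⟩ : PBond P j) ∈ Λ) (h2 : (⟨p.src.shift p.μ, p.ν⟩ : PBond P j) ∈ Λ)
    (h3 : (⟨p.src.shift p.ν, p.μ⟩ : PBond P j) ∈ Λ) (h4 : (⟨p.src, p.ν⟩ : PBond P j) ∈ Λ) (c : ℝ) :
    wordEval c (plaqWord Λ V x p) = wordExp (scale c (gens Λ p h1 h2 h3 h4 x)) := by
  unfold plaqWord gens letter
  rw [dif_pos h1, dif_pos h2, dif_pos h3, dif_pos h4]
  simp [wordEval, wordExp, scale, Letter.eval, smul_neg]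

omit [NeZero N] [DecidableEq (PBond P j)] in
/-- the classifier's generator sizes on the chart ball: `normSum (gens p x) ≤ 4S`. [folklore] -/
theorem normSum_gens_le [DecidableEq (PBond P j)] {S : ℝ} {x : BlockChartSU N Λ}
    (hx : x ∈ closedBall (0 : BlockChartSU N Λ) S)
    (p : Plaq P j) (h1 : (⟨p.src, p.μ⟩ : PBond P j) ∈ Λ) (h2 : (⟨p.src.shift p.μ, p.ν⟩ : PBond P j) ∈ Λ)
    (h3 : (⟨p.src.shift p.ν, p.μ⟩ : PBond P j) ∈ Λ) (h4 : (⟨p.src, p.ν⟩ : PBond P j) ∈ Λ) :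
    normSum (gens Λ p h1 h2 h3 h4 x) ≤ 4 * S := by
  unfold gens
  simp only [ShellMeasureWilsonWords.normSum_cons, ShellMeasureWilsonWords.normSum_nil, norm_neg]
  linarith [norm_gen_le Λ hx ⟨_, h1⟩, norm_gen_le Λ hx ⟨_, h2⟩, norm_gen_le Λ hx ⟨_, h3⟩, norm_gen_le Λ hx ⟨_, h4⟩]

end Letters

end Summit.QuantumFields.BalabanUV.T4Continuum.ShellMeasureWilsonRealizedSUN

end
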